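import Mathlib.Analysis.Seminorm
import Mathlib.Analysis.SpecialFunctions.Pow.Real
import Mathlib.Analysis.SpecialFunctions.Pow.Continuity
import Mathlib.Analysis.SpecificLimits.Basic
import Mathlib.Analysis.MeanInequalitiesPow
import HarnessLib

/-!
# Feldman–Salmhofer–Trubowitz IV — the abstract iteration theorem behind the inversion theorem
# (Theorem 2, part (3): existence of a unique solution of `E = e + K(e)`; part (4): continuity) — PROOFS

J. Feldman, M. Salmhofer, E. Trubowitz, *An inversion theorem in Fermi surface theory*, Comm. Pure
Appl. Math. **53** (2000) 1350–1384 = arXiv:math-ph/0001031 ("FST IV") [FeldmanSalmhoferTrubowitz2000].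
Render `paper:arxiv-math-ph_0001031` (locators `p.N:Ln` = chunk `pNNNN.txt`, line `n`).  "The main
ingredients in the inversion theorem are an abstract iteration theorem that generalizes the usual
contraction mapping theorem (which is not sufficient here) and a number of regularity estimates. The
estimates are used to verify the hypotheses of this iteration theorem" (§1 p.3:L29–35).  This file PROVES
that abstract iteration theorem = Theorem 2 part (3) (statement p.8:L48–67, proof p.8:L94–p.9:L32) and
its part (4) (continuity in `E` and `V`, statement p.8:L69–82, proof p.9:L34–125), with parts (1)
("Regularity", (r1), p.8:L10–17) and (2) ("Norm bounds for the iteration", (dr0)–(dr3), p.8:L19–46) as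
HYPOTHESES — exactly the printed logical structure ("Theorem 1 follows from the more detailed Theorem 2",
p.5:L39; parts (1), (2) are the inputs from FST I–III and Theorem 3, p.9:L127–185, not typed in this
wave; companion statement file `FermiRG/FSTInversion.lean`, row FSTinv.T1, untouched).

## Abstract setting (what "abstract" means here, decided by the printed proof)

The proof of part (3) uses of the function spaces only: four size functionals
`|·|₀ ≤ |·|₁ ≤ |·|₂ ≤ |·|_{3,r}` (§2.2 p.7:L143–158; `|·|_{3,r} = |·|₂ + ‖∂_r ·‖₂`), seminorm algebra for
`|·|₀, |·|₁, |·|₂`, completeness and the triangle inequality for `|·|_{3,r}` ("`Σ f_n` converges in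
`|·|_{3,r}`", p.8:L139–140), definiteness of `|·|₀` (uniqueness "follows from (dr0)", p.8:L141–142), and
convexity of the `|·|_{3,r}`-ball (`sup_t |e_t|_{3,r} ≤ 1 + G₃`, p.9:L26–27).  So: `X` a complete real
normed space whose norm plays `|·|_{3,r}`, `N0 N1 N2 : Seminorm ℝ X` with `N0 ≤ N1 ≤ N2 ≤ ‖·‖` and `N0`
definite (`NormLadder`); `K : X → X` plays `e ↦ K^{(R)}(e, λV)` at fixed `λ, V`; `G₃ = |E|_{3,r} = ‖E‖`.
The hypotheses (r1), (dr0)–(dr2) are required on the ball `B_ε^{(2)}(E) = {e : |e − E|₂ < ε}` (the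
print: (r1) on `𝓔(δ₀/2,g₀/2,2G₀,w₀/2) ⊇ B_ε^{(2)}(E)` by Lemma 2, (dr·) on `B_ε^{(2)}(E) ∩ C³`); the
`sup_{0≤t≤1} |e_t|_{3,r}` of (dr2) is typed as "for every `S` bounding all `‖(1−t)e₀ + te₁‖`, `t ∈ [0,1]`"
(equivalent, `Q₁ ≥ 1 > 0`).  The set `𝓔_R^E` of p.8:L55–58 is `{e : |e−E|₂ < ε, |e−E|_{3,r} < 1}` (`ballE`);
its clause "`e ∈ 𝓔(δ₀/2, …)`" is Lemma 2's business and is not part of the iteration argument.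

## What is proved (all `[cite: FeldmanSalmhoferTrubowitz2000, Thm 2 …]`)

* `iterate_mem_ball`, `iterate_bounds` — the iteration `e₀ = E`, `e_{n+1} = Φ(e_n) = E − K(e_n)`
  (p.8:L97–111) stays in `𝓔_R^E` and its increments `f_n = e_n − e_{n−1}` obey (ih0), (ih1), (ih3)
  (p.8:L119–135) with the printed `B_R(λ)`, `C_R(λ)`;
* `deltasatz_existence` — Theorem 2 (3): for `Q = max{Q₀ + Q₁(1 + G₃), D}` and `Q|λ| < min{1, ε}` there is
  a unique `e ∈ 𝓔_R^E` with `E = e + K(e)`, it is the limit of the iteration, and `|e − E|_{3,r} ≤ D|λ|`;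
* `deltasatz_continuity` — Theorem 2 (4) (p.8:L69–82).
The elementary case `λ = 0` (then `K = 0` on the ball by (r1)) is treated directly; for `λ ≠ 0` the
printed induction is followed line by line (the identities "equality holds in (e24)/(e25)" are
`rpow_mul_one_add_geomConst`).  Two implicit steps of the print are made explicit in part (4):
p.9:L40–46 uses `D|λ| + ε/2 < 1` and p.9:L120–125 uses `|E−E'|₀ ≤ |E−E'|₀^{δ²}`, i.e. `|E−E'|₀ ≤ 1`; both
follow from `ε ≤ 1` (Lemma 2's `ε` may always be shrunk), which we carry as an explicit hypothesis of
part (4); `|V−V'|₂ ≤ |V−V'|₂^{δ²}` uses the printed hypothesis `|V−V'|₂ ≤ 1`.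

No `sorry`, no new named fact (net fact debt 0); two `Prop`-valued hypothesis records (`NormLadder`,
`IterationBounds`) and one definition (`iter`, the printed iteration sequence).  Typer lint: no
`instance`, no `notation`, no attribute changes.
-/

noncomputable section

open Filter Topology

namespace Literature.MathematicalPhysics.QuantumLattice.FermiRG

namespace FST4

variable {X : Type*} [NormedAddCommGroup X]

section Hypotheses

variable [NormedSpace ℝ X]

/-! ### The abstract norm scale `|·|₀ ≤ |·|₁ ≤ |·|₂ ≤ |·|_{3,r}` -/

/-- The four size functionals of FST IV §2.2 (p.7:L143–158), abstractly: seminorms `N0 = |·|₀`,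
`N1 = |·|₁`, `N2 = |·|₂` on a real normed space whose norm plays `|·|_{3,r}`, ordered
`|·|₀ ≤ |·|₁ ≤ |·|₂ ≤ |·|_{3,r}` (immediate from the definitions `|F|_k = Σ_{l≤k} ‖F‖_l`,
`|F|_{p,r} = |F|_{p−1} + ‖∂_r F‖_{p−1}`, Lemma 3 (i)), with `|·|₀` (the sup norm) definite.
[cite: FeldmanSalmhoferTrubowitz2000, §2.2 p.7:L143-158] -/
structure NormLadder (N0 N1 N2 : Seminorm ℝ X) : Prop where
  /-- `|F|₀ ≤ |F|₁` -/
  le01 : ∀ x, N0 x ≤ N1 x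
  /-- `|F|₁ ≤ |F|₂` -/
  le12 : ∀ x, N1 x ≤ N2 x
  /-- `|F|₂ ≤ |F|_{3,r}` (Lemma 3 (i)) -/
  le2 : ∀ x, N2 x ≤ ‖x‖
  /-- `|F|₀ = 0 ⇒ F = 0` (the sup norm is a norm) -/
  eq_zero : ∀ x, N0 x = 0 → x = 0

/-- **Theorem 2, parts (1)–(2) as hypotheses** (p.8:L10–46), for the map `K = K^{(R)}(·, λV)` at fixed
`λ`, `V`, on the ball `B_ε^{(2)}(E) = {e : |e − E|₂ < ε}`:
(r1) "`|K^{(R)}(e)|_{3,r} = |K^{(R)}(e)|₂ < D_R|λ|`" (typed `≤`);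
(dr0) "`|K(e₁) − K(e₀)|₀ ≤ Q₀|λ| |e₁−e₀|₀`"; (dr1) "`|K(e₁) − K(e₀)|₁ ≤ Q₀|λ|[|e₁−e₀|₀^δ + |e₁−e₀|₁]`";
(dr2) "`|K(e₁) − K(e₀)|_{3,r} ≤ Q₀|λ|[|e₁−e₀|₁^δ + |e₁−e₀|₂] + Q₁|λ| sup_{0≤t≤1}|e_t|_{3,r} |e₁−e₀|₀`",
`e_t = (1−t)e₀ + te₁` (p.8:L3–4), the `sup` typed as any bound `S` of `t ↦ |e_t|_{3,r}` on `[0,1]`;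
with "`0 < δ < 1`", "`D_R ≥ 1`", "`Q₀, Q₁ ≥ 1`" as printed.  ((dr3), the `V`-dependence, enters only
part (4) and is a separate hypothesis there.) [cite: FeldmanSalmhoferTrubowitz2000, Thm 2 (1)-(2) p.8:L10-46] -/
structure IterationBounds (N0 N1 N2 : Seminorm ℝ X) (K : X → X) (E : X)
    (ε δ lam D Q0 Q1 : ℝ) : Prop where
  /-- `0 < δ` -/
  delta_pos : 0 < δ
  /-- `δ < 1` -/
  delta_lt_one : δ < 1
  /-- `D_R ≥ 1` -/
  one_le_D : 1 ≤ D
  /-- `Q₀ ≥ 1` -/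
  one_le_Q0 : 1 ≤ Q0
  /-- `Q₁ ≥ 1` -/
  one_le_Q1 : 1 ≤ Q1
  /-- (r1): `|K(e)|_{3,r} ≤ D_R |λ|` on the ball -/
  r1 : ∀ e, N2 (e - E) < ε → ‖K e‖ ≤ D * |lam|
  /-- (dr0) -/
  dr0 : ∀ e₀ e₁, N2 (e₀ - E) < ε → N2 (e₁ - E) < ε →
    N0 (K e₁ - K e₀) ≤ Q0 * |lam| * N0 (e₁ - e₀)
  /-- (dr1) -/
  dr1 : ∀ e₀ e₁, N2 (e₀ - E) < ε → N2 (e₁ - E) < ε →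
    N1 (K e₁ - K e₀) ≤ Q0 * |lam| * (N0 (e₁ - e₀) ^ δ + N1 (e₁ - e₀))
  /-- (dr2), with `S ≥ sup_{0 ≤ t ≤ 1} |e_t|_{3,r}` -/
  dr2 : ∀ e₀ e₁ (S : ℝ), N2 (e₀ - E) < ε → N2 (e₁ - E) < ε →
    (∀ t ∈ Set.Icc (0 : ℝ) 1, ‖(1 - t) • e₀ + t • e₁‖ ≤ S) →
    ‖K e₁ - K e₀‖ ≤ Q0 * |lam| * (N1 (e₁ - e₀) ^ δ + N2 (e₁ - e₀)) + Q1 * |lam| * S * N0 (e₁ - e₀)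

/-- The set `𝓔_R^E = {e : |e − E|₂ < ε, |e − E|_{3,r} < 1}` of Theorem 2 (3) (p.8:L55–58) — without its
clause `e ∈ 𝓔(δ₀/2, g₀/2, 2G₀, w₀/2)`, which Lemma 2 attaches to `|e − E|₂ < ε` and which plays no role in
the iteration. [cite: FeldmanSalmhoferTrubowitz2000, Thm 2 (3) p.8:L55-58] -/
def ballE (N2 : Seminorm ℝ X) (E : X) (ε : ℝ) : Set X :=
  {e | N2 (e - E) < ε ∧ ‖e - E‖ < 1}

end Hypotheses

/-- The iteration of the proof of Theorem 2 (3): "`Φ(e) = E − K(e)`", "`e₀ = E` and `e_{n+1} = Φ(e_n)`"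
(p.8:L97–111). [cite: FeldmanSalmhoferTrubowitz2000, Thm 2 (3) proof p.8:L97-111] -/
def iter (K : X → X) (E : X) (n : ℕ) : X :=
  (fun e => E - K e)^[n] E

section Basic

variable (K : X → X) (E : X)

/-- `e₀ = E`. [cite: FeldmanSalmhoferTrubowitz2000, Thm 2 (3) proof p.8:L108] -/
@[simp] theorem iter_zero : iter K E 0 = E := rfl

/-- `e_{n+1} = E − K(e_n)`. [cite: FeldmanSalmhoferTrubowitz2000, Thm 2 (3) proof p.8:L108-111] -/
theorem iter_succ (n : ℕ) : iter K E (n + 1) = E - K (iter K E n) := by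
  simp only [iter, Function.iterate_succ_apply']

/-- "`f_{n+1} = Φ(e_n) − Φ(e_{n−1}) = K(e_{n−1}) − K(e_n)`" (p.8:L113–116).
[cite: FeldmanSalmhoferTrubowitz2000, Thm 2 (3) proof p.8:L113-116] -/
theorem iter_succ_sub_iter_succ (n : ℕ) :
    iter K E (n + 2) - iter K E (n + 1) = -(K (iter K E (n + 1)) - K (iter K E n)) := by
  rw [iter_succ K E (n + 1), iter_succ K E n]; abel

/-- "`f₁ = −K(E)`" (p.8:L112). [cite: FeldmanSalmhoferTrubowitz2000, Thm 2 (3) proof p.8:L112] -/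
theorem iter_one_sub : iter K E 1 - iter K E 0 = -K E := by
  rw [iter_succ, iter_zero]; abel

end Basic

/-! ### Elementary real-number facts for `q = Q|λ| ∈ (0,1)` and `0 < δ < 1` -/

section RealFacts

variable {q δ : ℝ}

/-- `0 < q^a` for `q > 0`. [folklore] -/
private theorem rpow_pos' (hq : 0 < q) (a : ℝ) : 0 < q ^ a := Real.rpow_pos_of_pos hq a

/-- `q^a < 1` for `0 < q < 1`, `a > 0`. [folklore] -/
private theorem rpow_lt_one' (hq : 0 < q) (hq1 : q < 1) {a : ℝ} (ha : 0 < a) : q ^ a < 1 :=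
  Real.rpow_lt_one hq.le hq1 ha

/-- `q = q^{1−a} q^{a}`. [folklore] -/
private theorem split_rpow (hq : 0 < q) (a : ℝ) : q = q ^ (1 - a) * q ^ a := by
  rw [← Real.rpow_add hq, sub_add_cancel, Real.rpow_one]

/-- "`B_R(λ) = (Q|λ|)^{1−δ} / (1 − (Q|λ|)^{1−δ})`" and "`C_R(λ) = (Q|λ|)^{1−δ²}/(1 − (Q|λ|)^{1−δ²})`"
(p.8:L129–135), as functions of `q = Q|λ|` and of the exponent `a = 1−δ`, resp. `1−δ²`.
[cite: FeldmanSalmhoferTrubowitz2000, Thm 2 (3) proof p.8:L129-135] -/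
def geomConst (q a : ℝ) : ℝ := q ^ a / (1 - q ^ a)

/-- `geomConst q a ≥ 0` on `0 < q < 1`, `a > 0`. [cite: FeldmanSalmhoferTrubowitz2000, Thm 2 (3) proof p.8:L129-135] -/
theorem geomConst_nonneg (hq : 0 < q) (hq1 : q < 1) {a : ℝ} (ha : 0 < a) : 0 ≤ geomConst q a :=
  div_nonneg (rpow_pos' hq a).le (sub_nonneg.2 (rpow_lt_one' hq hq1 ha).le)

/-- "equality holds in (e24)" / "(e25)": `q^a (1 + G) = G` for `G = q^a/(1 − q^a)` (p.9:L1–2, L30–31).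
[cite: FeldmanSalmhoferTrubowitz2000, Thm 2 (3) proof p.9:L1-2] -/
theorem rpow_mul_one_add_geomConst (hq : 0 < q) (hq1 : q < 1) {a : ℝ} (ha : 0 < a) :
    q ^ a * (1 + geomConst q a) = geomConst q a := by
  have h1 : 1 - q ^ a ≠ 0 := (sub_pos.2 (rpow_lt_one' hq hq1 ha)).ne'
  unfold geomConst
  field_simp
  ring

/-- The base-case inequality "`(Q|λ|)^δ B_R(λ) = Q|λ|/(1 − (Q|λ|)^{1−δ}) > Q|λ|`" (p.8:L152–160), in the
form `q ≤ geomConst q (1−a') · q^{a'}` with `(1 − a') + a' = 1`: here `q ≤ G q^{b}` whenever `a + b = 1`.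
[cite: FeldmanSalmhoferTrubowitz2000, Thm 2 (3) proof p.8:L152-160] -/
theorem le_geomConst_mul_rpow (hq : 0 < q) (hq1 : q < 1) {a b : ℝ} (ha : 0 < a) (hab : a + b = 1) :
    q ≤ geomConst q a * q ^ b := by
  have hlt : q ^ a < 1 := rpow_lt_one' hq hq1 ha
  have hpos : 0 < 1 - q ^ a := sub_pos.2 hlt
  have hsplit : q = q ^ a * q ^ b := by
    rw [← Real.rpow_add hq, hab, Real.rpow_one]
  unfold geomConst
  rw [div_mul_eq_mul_div, le_div_iff₀ hpos, ← hsplit]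
  have : 0 ≤ q * q ^ a := mul_nonneg hq.le (rpow_pos' hq a).le
  nlinarith

end RealFacts

/-! ### The constant `Q = max{Q₀ + Q₁(1+G₃), D}` -/

section BigQ

/-- "`Q = max{Q₀ + Q₁(1+G₃), D}`" (p.8:L52), for a bound `G₃ ≥ |E|_{3,r}` ("Let `E ∈ 𝓔(δ₀,g₀,G₀,w₀)` with
`|E|_{3,r} = G₃ < ∞`", p.8:L49–50; any upper bound serves, as in Theorem 1 where `G₃` bounds `|E|₃`).
[cite: FeldmanSalmhoferTrubowitz2000, Thm 2 (3) p.8:L49-52] -/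
def bigQ (Q0 Q1 D G₃ : ℝ) : ℝ := max (Q0 + Q1 * (1 + G₃)) D

/-- `D ≤ Q`. [cite: FeldmanSalmhoferTrubowitz2000, Thm 2 (3) p.8:L52] -/
theorem D_le_bigQ (Q0 Q1 D G₃ : ℝ) : D ≤ bigQ Q0 Q1 D G₃ := le_max_right _ _

/-- `Q₀ + Q₁(1+G₃) ≤ Q`. [cite: FeldmanSalmhoferTrubowitz2000, Thm 2 (3) p.8:L52] -/
theorem Q0_add_le_bigQ (Q0 Q1 D G₃ : ℝ) : Q0 + Q1 * (1 + G₃) ≤ bigQ Q0 Q1 D G₃ := le_max_left _ _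

end BigQ

/-! ### The iteration stays in `𝓔_R^E` (p.8:L103–111) -/

section Iteration

variable [NormedSpace ℝ X] {N0 N1 N2 : Seminorm ℝ X} {K : X → X} {E : X} {ε δ lam D Q0 Q1 : ℝ}

/-- "`|Φ(e) − E|_{3,r} = |K(e)|_{3,r} ≤ D_R|λ| ≤ Qλ_R < min{ε,1}`, so `Φ(B) ⊂ B`" (p.8:L103–107): every
iterate `e_n`, `n ≥ 1`, satisfies `|e_n − E|_{3,r} ≤ D_R|λ|`, and all iterates lie in `𝓔_R^E`.
[cite: FeldmanSalmhoferTrubowitz2000, Thm 2 (3) proof p.8:L103-111] -/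
theorem iterate_mem_ball (hK : IterationBounds N0 N1 N2 K E ε δ lam D Q0 Q1) (hN : NormLadder N0 N1 N2)
    (hε : 0 < ε) (hD1 : D * |lam| < 1) (hDε : D * |lam| < ε) (n : ℕ) :
    iter K E n ∈ ballE N2 E ε ∧ ‖iter K E (n + 1) - E‖ ≤ D * |lam| := by
  induction n with
  | zero =>
    refine ⟨⟨?_, ?_⟩, ?_⟩
    · simpa [iter_zero, map_zero] using hε
    · simp [iter_zero]
    · rw [iter_succ, iter_zero, sub_sub_cancel_left, norm_neg]
      exact hK.r1 E (by simpa [map_zero] using hε)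
  | succ n ih =>
    have hmem : iter K E (n + 1) ∈ ballE N2 E ε :=
      ⟨lt_of_le_of_lt ((hN.le2 _).trans ih.2) hDε, lt_of_le_of_lt ih.2 hD1⟩
    refine ⟨hmem, ?_⟩
    rw [iter_succ K E (n + 1), sub_sub_cancel_left, norm_neg]
    exact hK.r1 _ hmem.1

/-- Convexity of the `|·|_{3,r}`-ball: for `e₀, e₁ ∈ 𝓔_R^E`, "`sup_t |e_t|_{3,r} ≤ 1 + |E|_{3,r}`"
(p.9:L26–27: "`e_n ∈ B` implies `|e_n|_{3,r} ≤ 1 + |E|_{3,r} ≤ 1 + G₃`").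
[cite: FeldmanSalmhoferTrubowitz2000, Thm 2 (3) proof p.9:L26-27] -/
theorem norm_convexComb_le {e₀ e₁ E : X} (h₀ : ‖e₀ - E‖ ≤ 1) (h₁ : ‖e₁ - E‖ ≤ 1)
    {t : ℝ} (ht : t ∈ Set.Icc (0 : ℝ) 1) : ‖(1 - t) • e₀ + t • e₁‖ ≤ 1 + ‖E‖ := by
  have ht0 : 0 ≤ t := ht.1
  have ht1 : 0 ≤ 1 - t := sub_nonneg.2 ht.2
  have hdecomp : (1 - t) • e₀ + t • e₁ = E + ((1 - t) • (e₀ - E) + t • (e₁ - E)) := by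
    have hE : ((1 - t) • E + t • E : X) = E := by rw [← add_smul, sub_add_cancel, one_smul]
    simp only [smul_sub]
    calc (1 - t) • e₀ + t • e₁
        = ((1 - t) • E + t • E) + ((1 - t) • e₀ - (1 - t) • E + (t • e₁ - t • E)) := by abel
      _ = E + ((1 - t) • e₀ - (1 - t) • E + (t • e₁ - t • E)) := by rw [hE]
  rw [hdecomp]
  calc ‖E + ((1 - t) • (e₀ - E) + t • (e₁ - E))‖
      ≤ ‖E‖ + (‖(1 - t) • (e₀ - E)‖ + ‖t • (e₁ - E)‖) :=
        (norm_add_le _ _).trans (add_le_add le_rfl (norm_add_le _ _))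
    _ = ‖E‖ + ((1 - t) * ‖e₀ - E‖ + t * ‖e₁ - E‖) := by
        rw [norm_smul, norm_smul, Real.norm_of_nonneg ht1, Real.norm_of_nonneg ht0]
    _ ≤ ‖E‖ + ((1 - t) * 1 + t * 1) := by gcongr
    _ = 1 + ‖E‖ := by ring

/-- **The three-norm induction (ih0), (ih1), (ih3)** of the proof of Theorem 2 (3) (p.8:L119–135 with
p.8:L143–p.9:L31): writing `f_{n+1} = e_{n+1} − e_n`, `q = Q|λ|`, `B_R = q^{1−δ}/(1−q^{1−δ})`,
`C_R = q^{1−δ²}/(1−q^{1−δ²})`, for all `n ≥ 0`: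
`|f_{n+1}|₀ ≤ q^{n+1}`, `|f_{n+1}|₁ ≤ B_R q^{(n+1)δ}`, `|f_{n+1}|_{3,r} ≤ C_R max{B_R^δ, 1} q^{(n+1)δ²}`.
Here `q` is any number with `D|λ| ≤ q`, `(Q₀ + Q₁(1 + |E|_{3,r}))|λ| ≤ q` and `0 < q < min{1, ε}` (the
print: `q = Q|λ|`, `Q = max{Q₀ + Q₁(1+G₃), D}`, `λ ≠ 0`).
[cite: FeldmanSalmhoferTrubowitz2000, Thm 2 (3) proof p.8:L119-135] -/
theorem iterate_bounds (hK : IterationBounds N0 N1 N2 K E ε δ lam D Q0 Q1) (hN : NormLadder N0 N1 N2)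
    {q : ℝ} (hq0 : 0 < q) (hq1 : q < 1) (hqε : q < ε) (hDq : D * |lam| ≤ q)
    (hQq : (Q0 + Q1 * (1 + ‖E‖)) * |lam| ≤ q) (n : ℕ) :
    N0 (iter K E (n + 1) - iter K E n) ≤ q ^ (n + 1) ∧
    N1 (iter K E (n + 1) - iter K E n) ≤ geomConst q (1 - δ) * (q ^ δ) ^ (n + 1) ∧
    ‖iter K E (n + 1) - iter K E n‖ ≤
      geomConst q (1 - δ ^ 2) * max (geomConst q (1 - δ) ^ δ) 1 * (q ^ (δ ^ 2)) ^ (n + 1) := by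
  -- constants and their signs
  have hδ := hK.delta_pos
  have hδ1 := hK.delta_lt_one
  have h1δ : 0 < 1 - δ := sub_pos.2 hδ1
  have hδsq1 : δ ^ 2 < 1 := by nlinarith
  have h1δ2 : 0 < 1 - δ ^ 2 := sub_pos.2 hδsq1
  set B := geomConst q (1 - δ) with hBdef
  set C := geomConst q (1 - δ ^ 2) with hCdef
  set M := max (B ^ δ) 1 with hMdef
  have hB : 0 ≤ B := geomConst_nonneg hq0 hq1 h1δ
  have hC : 0 ≤ C := geomConst_nonneg hq0 hq1 h1δ2
  have hM1 : 1 ≤ M := le_max_right _ _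
  have hM0 : 0 ≤ M := zero_le_one.trans hM1
  have hqd : 0 ≤ q ^ δ := (Real.rpow_pos_of_pos hq0 _).le
  have hqd2 : 0 ≤ q ^ (δ ^ 2) := (Real.rpow_pos_of_pos hq0 _).le
  have hε : 0 < ε := hq0.trans hqε
  have hD1 : D * |lam| < 1 := hDq.trans_lt hq1
  have hDε : D * |lam| < ε := hDq.trans_lt hqε
  have hQ1nn : 0 ≤ Q1 * (1 + ‖E‖) := mul_nonneg (zero_le_one.trans hK.one_le_Q1) (by positivity)
  have hQ0q : Q0 * |lam| ≤ q :=
    (mul_le_mul_of_nonneg_right (le_add_of_nonneg_right hQ1nn) (abs_nonneg lam)).trans hQq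
  have hQ0nn : 0 ≤ Q0 * |lam| := mul_nonneg (zero_le_one.trans hK.one_le_Q0) (abs_nonneg lam)
  -- (e24), (e25): `q^{1-δ}(1+B) = B`, `q^{1-δ²}(1+C) = C`
  have e24 : q ^ (1 - δ) * (1 + B) = B := rpow_mul_one_add_geomConst hq0 hq1 h1δ
  have e25 : q ^ (1 - δ ^ 2) * (1 + C) = C := rpow_mul_one_add_geomConst hq0 hq1 h1δ2
  have hsplit1 : q = q ^ (1 - δ) * q ^ δ := split_rpow hq0 δ
  have hsplit2 : q = q ^ (1 - δ ^ 2) * q ^ (δ ^ 2) := split_rpow hq0 (δ ^ 2)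
  have mem := fun n => (iterate_mem_ball hK hN hε hD1 hDε n)
  induction n with
  | zero =>
    -- `f₁ = -K(E)`, `|f₁|₀ ≤ |f₁|₁ ≤ |f₁|_{3,r} = |K(E)|_{3,r} ≤ D_R|λ| ≤ Q|λ|` (p.8:L145-150)
    have hKE : ‖K E‖ ≤ q := (hK.r1 E (by simpa [map_zero] using hε)).trans hDq
    rw [zero_add, iter_one_sub, map_neg_eq_map, map_neg_eq_map, norm_neg]
    have h2 : N2 (K E) ≤ q := (hN.le2 _).trans hKE
    have h1 : N1 (K E) ≤ q := (hN.le12 _).trans h2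
    have h0 : N0 (K E) ≤ q := (hN.le01 _).trans h1
    refine ⟨by simpa using h0, ?_, ?_⟩
    · rw [pow_one]
      exact h1.trans (le_geomConst_mul_rpow hq0 hq1 h1δ (by ring))
    · rw [pow_one]
      calc ‖K E‖ ≤ q := hKE
        _ ≤ C * q ^ (δ ^ 2) := le_geomConst_mul_rpow hq0 hq1 h1δ2 (by ring)
        _ = C * 1 * q ^ (δ ^ 2) := by ring
        _ ≤ C * M * q ^ (δ ^ 2) := by gcongr
  | succ n ih =>
    obtain ⟨ih0, ih1, ih3⟩ := ih
    -- `e₀ = e_n`, `e₁ = e_{n+1}`, `f = f_{n+1} = e₁ - e₀`, `f_{n+2} = -(K e₁ - K e₀)`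
    set e₀ := iter K E n with he₀
    set e₁ := iter K E (n + 1) with he₁
    have hm₀ : e₀ ∈ ballE N2 E ε := (mem n).1
    have hm₁ : e₁ ∈ ballE N2 E ε := (mem (n + 1)).1
    have hf : iter K E (n + 1 + 1) - iter K E (n + 1) = -(K e₁ - K e₀) :=
      iter_succ_sub_iter_succ K E n
    rw [hf, map_neg_eq_map, map_neg_eq_map, norm_neg]
    have hN0f : 0 ≤ N0 (e₁ - e₀) := apply_nonneg _ _
    have hN1f : 0 ≤ N1 (e₁ - e₀) := apply_nonneg _ _
    refine ⟨?_, ?_, ?_⟩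
    · -- (ih0): `|f_{n+2}|₀ ≤ Q₀|λ| |f_{n+1}|₀ ≤ q · q^{n+1}` (p.8:L167-172)
      calc N0 (K e₁ - K e₀) ≤ Q0 * |lam| * N0 (e₁ - e₀) := hK.dr0 e₀ e₁ hm₀.1 hm₁.1
        _ ≤ q * q ^ (n + 1) := mul_le_mul hQ0q ih0 hN0f hq0.le
        _ = q ^ (n + 1 + 1) := by ring
    · -- (ih1): p.8:L174-p.9:L2
      have hpow : N0 (e₁ - e₀) ^ δ ≤ (q ^ δ) ^ (n + 1) := by
        rw [Real.rpow_pow_comm hq0.le δ (n + 1)]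
        exact Real.rpow_le_rpow hN0f ih0 hδ.le
      calc N1 (K e₁ - K e₀) ≤ Q0 * |lam| * (N0 (e₁ - e₀) ^ δ + N1 (e₁ - e₀)) :=
            hK.dr1 e₀ e₁ hm₀.1 hm₁.1
        _ ≤ q * ((q ^ δ) ^ (n + 1) + B * (q ^ δ) ^ (n + 1)) := by
            apply mul_le_mul hQ0q (add_le_add hpow ih1) (by positivity) hq0.le
        _ = q * (1 + B) * (q ^ δ) ^ (n + 1) := by ring
        _ = (q ^ (1 - δ) * q ^ δ) * (1 + B) * (q ^ δ) ^ (n + 1) := by rw [← hsplit1]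
        _ = (q ^ (1 - δ) * (1 + B)) * (q ^ δ) ^ (n + 1 + 1) := by ring
        _ = B * (q ^ δ) ^ (n + 1 + 1) := by rw [e24]
    · -- (ih3): p.9:L4-31, with `sup_t |e_t|_{3,r} ≤ 1 + G₃`
      have hS : ∀ t ∈ Set.Icc (0 : ℝ) 1, ‖(1 - t) • e₀ + t • e₁‖ ≤ 1 + ‖E‖ :=
        fun t ht => norm_convexComb_le hm₀.2.le hm₁.2.le ht
      have hpow1 : N1 (e₁ - e₀) ^ δ ≤ B ^ δ * (q ^ (δ ^ 2)) ^ (n + 1) := by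
        have : (B * (q ^ δ) ^ (n + 1)) ^ δ = B ^ δ * (q ^ (δ ^ 2)) ^ (n + 1) := by
          rw [Real.mul_rpow hB (pow_nonneg hqd _), ← Real.rpow_pow_comm hqd δ (n + 1),
            ← Real.rpow_mul hq0.le, sq]
        rw [← this]
        exact Real.rpow_le_rpow hN1f ih1 hδ.le
      have hBM : B ^ δ ≤ M := le_max_left _ _
      calc ‖K e₁ - K e₀‖
          ≤ Q0 * |lam| * (N1 (e₁ - e₀) ^ δ + N2 (e₁ - e₀)) +
              Q1 * |lam| * (1 + ‖E‖) * N0 (e₁ - e₀) := hK.dr2 e₀ e₁ _ hm₀.1 hm₁.1 hS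
        _ ≤ Q0 * |lam| * N1 (e₁ - e₀) ^ δ + (Q0 + Q1 * (1 + ‖E‖)) * |lam| * N2 (e₁ - e₀) := by
            have h02 : N0 (e₁ - e₀) ≤ N2 (e₁ - e₀) := (hN.le01 _).trans (hN.le12 _)
            have hQ1_0 : 0 ≤ Q1 := zero_le_one.trans hK.one_le_Q1
            have : Q1 * |lam| * (1 + ‖E‖) * N0 (e₁ - e₀) ≤ Q1 * |lam| * (1 + ‖E‖) * N2 (e₁ - e₀) :=
              mul_le_mul_of_nonneg_left h02
                (mul_nonneg (mul_nonneg hQ1_0 (abs_nonneg _)) (by positivity))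
            nlinarith
        _ ≤ q * N1 (e₁ - e₀) ^ δ + q * ‖e₁ - e₀‖ := by
            have hr : 0 ≤ N1 (e₁ - e₀) ^ δ := Real.rpow_nonneg hN1f _
            have := hN.le2 (e₁ - e₀)
            have hN2f : 0 ≤ N2 (e₁ - e₀) := apply_nonneg _ _
            nlinarith [mul_le_mul hQ0q le_rfl hr hq0.le, mul_le_mul hQq this hN2f hq0.le]
        _ ≤ q * (B ^ δ * (q ^ (δ ^ 2)) ^ (n + 1)) + q * (C * M * (q ^ (δ ^ 2)) ^ (n + 1)) := by
            gcongr
        _ ≤ q * (M * (q ^ (δ ^ 2)) ^ (n + 1)) + q * (C * M * (q ^ (δ ^ 2)) ^ (n + 1)) := by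
            gcongr
        _ = q * (M * (1 + C)) * (q ^ (δ ^ 2)) ^ (n + 1) := by ring
        _ = (q ^ (1 - δ ^ 2) * q ^ (δ ^ 2)) * (M * (1 + C)) * (q ^ (δ ^ 2)) ^ (n + 1) := by
            rw [← hsplit2]
        _ = M * (q ^ (1 - δ ^ 2) * (1 + C)) * (q ^ (δ ^ 2)) ^ (n + 1 + 1) := by ring
        _ = C * M * (q ^ (δ ^ 2)) ^ (n + 1 + 1) := by rw [e25]; ring

/-! ### Theorem 2 (3): existence of a unique solution to the inversion equation -/

/-- "Since `Q₀|λ| < 1`, uniqueness follows from (dr0)" (p.8:L141–142): two solutions of `e + K(e) = E`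
in `𝓔_R^E` coincide (`|e' − e|₀ ≤ Q₀|λ| |e' − e|₀` and `|·|₀` is definite).
[cite: FeldmanSalmhoferTrubowitz2000, Thm 2 (3) proof p.8:L141-142] -/
theorem solution_unique (hK : IterationBounds N0 N1 N2 K E ε δ lam D Q0 Q1) (hN : NormLadder N0 N1 N2)
    (hQ0 : Q0 * |lam| < 1) {e e' : X} (he : e ∈ ballE N2 E ε) (he' : e' ∈ ballE N2 E ε)
    (hsol : e + K e = E) (hsol' : e' + K e' = E) : e' = e := by
  have hdiff : e' - e = -(K e' - K e) := by
    calc e' - e = (e' + K e') - (e + K e) - (K e' - K e) := by abel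
      _ = E - E - (K e' - K e) := by rw [hsol, hsol']
      _ = -(K e' - K e) := by abel
  have h0 : N0 (e' - e) ≤ Q0 * |lam| * N0 (e' - e) := by
    conv_lhs => rw [hdiff, map_neg_eq_map]
    exact hK.dr0 e e' he.1 he'.1
  have hnn : 0 ≤ N0 (e' - e) := apply_nonneg _ _
  have hz : N0 (e' - e) = 0 := by nlinarith
  exact sub_eq_zero.1 (hN.eq_zero _ hz)

/-- "(Ala)": every solution `e ∈ 𝓔_R^E` of `E = e + K(e)` satisfies `|e − E|_{3,r} ≤ D_R|λ|` (p.8:L65–67;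
by (r1), since `e − E = −K(e)`). [cite: FeldmanSalmhoferTrubowitz2000, Thm 2 (3) p.8:L65-67] -/
theorem norm_sub_le_of_solution (hK : IterationBounds N0 N1 N2 K E ε δ lam D Q0 Q1) {e : X}
    (he : e ∈ ballE N2 E ε) (hsol : e + K e = E) : ‖e - E‖ ≤ D * |lam| := by
  have : e - E = -K e := by rw [← hsol]; abel
  rw [this, norm_neg]
  exact hK.r1 e he.1

/-- **Theorem 2 (3), existence of a unique solution to the inversion equation** (p.8:L48–67): "Let
`E ∈ 𝓔(δ₀,g₀,G₀,w₀)` with `|E|_{3,r} = G₃ < ∞`. Set `Q = max{Q₀ + Q₁(1+G₃), D}`. Let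
`𝓔_R^E = {e : |e − E|₂ < ε, |e − E|_{3,r} < 1}` and let `λ_R > 0` be such that `Qλ_R < min{1,ε}`. Then
for all `|λ| ≤ λ_R` and all `V ∈ 𝓥`, there is a unique `e^{(R)} ∈ 𝓔_R^E` such that
`E = e^{(R)} + K^{(R)}(e^{(R)}, λV)`. Moreover `|e^{(R)} − E|_{3,r} ≤ D_R|λ|`" — in the abstract setting of
this file (parts (1), (2) as the hypothesis `IterationBounds`, `G₃ ≥ ‖E‖ = |E|_{3,r}`), together with the printed
construction: `e^{(R)} = lim_n e_n` is the limit of the iteration `e₀ = E`, `e_{n+1} = E − K(e_n)`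
(proof p.8:L94–p.9:L32; the case `λ = 0`, where (r1) forces `K = 0` on the ball, is immediate).
[cite: FeldmanSalmhoferTrubowitz2000, Thm 2 (3) p.8:L48-67] -/
theorem deltasatz_existence [CompleteSpace X] (hK : IterationBounds N0 N1 N2 K E ε δ lam D Q0 Q1)
    (hN : NormLadder N0 N1 N2) {G₃ : ℝ} (hG : ‖E‖ ≤ G₃) (hq : bigQ Q0 Q1 D G₃ * |lam| < min 1 ε) :
    ∃ e, e ∈ ballE N2 E ε ∧ e + K e = E ∧ ‖e - E‖ ≤ D * |lam| ∧
      Tendsto (iter K E) atTop (𝓝 e) ∧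
      ∀ e', e' ∈ ballE N2 E ε → e' + K e' = E → e' = e := by
  have hδ := hK.delta_pos
  have hQD := D_le_bigQ Q0 Q1 D G₃
  have hQ1le : 1 ≤ bigQ Q0 Q1 D G₃ := hK.one_le_D.trans hQD
  have hQnn : 0 ≤ bigQ Q0 Q1 D G₃ := zero_le_one.trans hQ1le
  have hDq : D * |lam| ≤ bigQ Q0 Q1 D G₃ * |lam| := mul_le_mul_of_nonneg_right hQD (abs_nonneg lam)
  have hq1 : bigQ Q0 Q1 D G₃ * |lam| < 1 := hq.trans_le (min_le_left _ _)
  have hqε : bigQ Q0 Q1 D G₃ * |lam| < ε := hq.trans_le (min_le_right _ _)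
  have hD1 : D * |lam| < 1 := hDq.trans_lt hq1
  have hDε : D * |lam| < ε := hDq.trans_lt hqε
  have hε : 0 < ε := (mul_nonneg hQnn (abs_nonneg lam)).trans_lt hqε
  have hQ1_0 : 0 ≤ Q1 := zero_le_one.trans hK.one_le_Q1
  have hQ1nn : 0 ≤ Q1 * (1 + ‖E‖) := mul_nonneg hQ1_0 (by positivity)
  have hQq : (Q0 + Q1 * (1 + ‖E‖)) * |lam| ≤ bigQ Q0 Q1 D G₃ * |lam| := by
    refine mul_le_mul_of_nonneg_right (le_trans ?_ (Q0_add_le_bigQ Q0 Q1 D G₃)) (abs_nonneg lam)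
    have := mul_le_mul_of_nonneg_left (add_le_add_left hG 1) hQ1_0
    linarith
  have hQ0q : Q0 * |lam| ≤ bigQ Q0 Q1 D G₃ * |lam| :=
    (mul_le_mul_of_nonneg_right (le_add_of_nonneg_right hQ1nn) (abs_nonneg lam)).trans hQq
  have hQ0lt : Q0 * |lam| < 1 := hQ0q.trans_lt hq1
  have hQ0nn : 0 ≤ Q0 * |lam| := mul_nonneg (zero_le_one.trans hK.one_le_Q0) (abs_nonneg lam)
  have mem := fun n => iterate_mem_ball hK hN hε hD1 hDε n
  have hE0 : N2 (E - E) < ε := by simpa [map_zero] using hε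
  have huniq : ∀ e e', e ∈ ballE N2 E ε → e' ∈ ballE N2 E ε → e + K e = E → e' + K e' = E →
      e' = e := fun e e' he he' h h' => solution_unique hK hN hQ0lt he he' h h'
  rcases eq_or_ne lam 0 with hlam | hlam
  · -- `λ = 0`: (r1) gives `K = 0` on the ball, the iteration is constant and `e = E`.
    have hK0 : ∀ e, N2 (e - E) < ε → K e = 0 := fun e he => by
      have h := hK.r1 e he
      rw [hlam, abs_zero, mul_zero] at h
      exact norm_le_zero_iff.1 h
    have hEmem : E ∈ ballE N2 E ε := by simpa using (mem 0).1
    have hconst : ∀ n, iter K E n = E := by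
      intro n
      induction n with
      | zero => rfl
      | succ n ih => rw [iter_succ, ih, hK0 E hE0, sub_zero]
    refine ⟨E, hEmem, by rw [hK0 E hE0, add_zero], by simp [hlam], ?_, fun e' he' h' =>
      huniq E e' hEmem he' (by rw [hK0 E hE0, add_zero]) h'⟩
    exact tendsto_const_nhds.congr fun n => (hconst n).symm
  · -- `λ ≠ 0`: the printed iteration argument with `q = Q|λ| > 0`.
    set q := bigQ Q0 Q1 D G₃ * |lam| with hqdef
    have hq0 : 0 < q := mul_pos (zero_lt_one.trans_le hQ1le) (abs_pos.2 hlam)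
    have bnd := fun n => iterate_bounds hK hN hq0 hq1 hqε hDq hQq n
    -- the increments decay geometrically with ratio `r = q^{δ²} < 1`
    set r := q ^ (δ ^ 2) with hrdef
    have hr1 : r < 1 := Real.rpow_lt_one hq0.le hq1 (pow_pos hδ 2)
    set Cst := geomConst q (1 - δ ^ 2) * max (geomConst q (1 - δ) ^ δ) 1 with hCst
    have hdist : ∀ n, dist (iter K E n) (iter K E (n + 1)) ≤ Cst * r * r ^ n := by
      intro n
      rw [dist_eq_norm, ← norm_neg, neg_sub]
      calc ‖iter K E (n + 1) - iter K E n‖ ≤ Cst * r ^ (n + 1) := (bnd n).2.2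
        _ = Cst * r * r ^ n := by ring
    have hcauchy : CauchySeq (iter K E) := cauchySeq_of_le_geometric r (Cst * r) hr1 hdist
    obtain ⟨e, he⟩ := cauchySeq_tendsto_of_complete hcauchy
    have h1 : Tendsto (fun n => iter K E (n + 1)) atTop (𝓝 e) := he.comp (tendsto_add_atTop_nat 1)
    -- `|e - E|_{3,r} ≤ D|λ|`: all `e_n`, `n ≥ 1`, lie in the closed `D|λ|`-ball around `E`
    have hbound : ‖e - E‖ ≤ D * |lam| := by
      have hmemc : ∀ n, iter K E (n + 1) ∈ Metric.closedBall E (D * |lam|) := fun n => by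
        rw [Metric.mem_closedBall, dist_eq_norm]; exact (mem n).2
      have := Metric.isClosed_closedBall.mem_of_tendsto h1 (Eventually.of_forall hmemc)
      rwa [Metric.mem_closedBall, dist_eq_norm] at this
    have hemem : e ∈ ballE N2 E ε :=
      ⟨((hN.le2 _).trans hbound).trans_lt hDε, hbound.trans_lt hD1⟩
    -- `Φ` is continuous in `|·|_{3,r}` along the sequence ("By (eq35), `Φ` is continuous", p.8:L139-140)
    have hKlim : Tendsto (fun n => K (iter K E n)) atTop (𝓝 (K e)) := by
      have hd : Tendsto (fun n => ‖iter K E n - e‖) atTop (𝓝 0) :=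
        tendsto_iff_norm_sub_tendsto_zero.1 he
      have hdδ : Tendsto (fun n => ‖iter K E n - e‖ ^ δ) atTop (𝓝 0) := by
        have := hd.rpow_const (Or.inr hδ.le)
        rwa [Real.zero_rpow hδ.ne'] at this
      have hg : Tendsto (fun n => Q0 * |lam| * (‖iter K E n - e‖ ^ δ + ‖iter K E n - e‖) +
          Q1 * |lam| * (1 + ‖E‖) * ‖iter K E n - e‖) atTop (𝓝 0) := by
        have := ((hdδ.add hd).const_mul (Q0 * |lam|)).add (hd.const_mul (Q1 * |lam| * (1 + ‖E‖)))
        simpa using this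
      refine tendsto_iff_norm_sub_tendsto_zero.2
        (squeeze_zero (fun n => norm_nonneg _) (fun n => ?_) hg)
      have hS : ∀ t ∈ Set.Icc (0 : ℝ) 1, ‖(1 - t) • e + t • iter K E n‖ ≤ 1 + ‖E‖ :=
        fun t ht => norm_convexComb_le hemem.2.le (mem n).1.2.le ht
      have h := hK.dr2 e (iter K E n) (1 + ‖E‖) hemem.1 (mem n).1.1 hS
      have hn0 : N0 (iter K E n - e) ≤ ‖iter K E n - e‖ :=
        ((hN.le01 _).trans (hN.le12 _)).trans (hN.le2 _)
      have hn1 : N1 (iter K E n - e) ≤ ‖iter K E n - e‖ := (hN.le12 _).trans (hN.le2 _)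
      have hn2 : N2 (iter K E n - e) ≤ ‖iter K E n - e‖ := hN.le2 _
      have hn1δ : N1 (iter K E n - e) ^ δ ≤ ‖iter K E n - e‖ ^ δ :=
        Real.rpow_le_rpow (apply_nonneg _ _) hn1 hδ.le
      have hQ1c : 0 ≤ Q1 * |lam| * (1 + ‖E‖) :=
        mul_nonneg (mul_nonneg (zero_le_one.trans hK.one_le_Q1) (abs_nonneg _)) (by positivity)
      exact h.trans (add_le_add (mul_le_mul_of_nonneg_left (add_le_add hn1δ hn2) hQ0nn)
        (mul_le_mul_of_nonneg_left hn0 hQ1c))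
    -- `Φ(e) = e`: `e_{n+1} = E - K(e_n) → E - K(e)` and `e_{n+1} → e`
    have h2 : Tendsto (fun n => iter K E (n + 1)) atTop (𝓝 (E - K e)) :=
      (hKlim.const_sub E).congr fun n => (iter_succ K E n).symm
    have hfix : e = E - K e := tendsto_nhds_unique h1 h2
    have hsol : e + K e = E := eq_sub_iff_add_eq.1 hfix
    exact ⟨e, hemem, hsol, hbound, he, fun e' he' h' => huniq e e' hemem he' hsol h'⟩

/-- Theorem 2 (3) in the printed "there is a unique `e^{(R)} ∈ 𝓔_R^E`" form.
[cite: FeldmanSalmhoferTrubowitz2000, Thm 2 (3) p.8:L60-63] -/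
theorem deltasatz_existsUnique [CompleteSpace X] (hK : IterationBounds N0 N1 N2 K E ε δ lam D Q0 Q1)
    (hN : NormLadder N0 N1 N2) {G₃ : ℝ} (hG : ‖E‖ ≤ G₃) (hq : bigQ Q0 Q1 D G₃ * |lam| < min 1 ε) :
    ∃! e, e ∈ ballE N2 E ε ∧ e + K e = E := by
  obtain ⟨e, he, hsol, -, -, huniq⟩ := deltasatz_existence hK hN hG hq
  exact ⟨e, ⟨he, hsol⟩, fun e' h' => huniq e' h'.1 h'.2⟩

/-! ### Theorem 2 (4): continuity in `E` and `V` -/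

/-- `x^{δ}` is subadditive and `(2x)^δ ≤ 2x^δ`-type bookkeeping: for `0 ≤ a, b` and `0 < δ < 1`,
`(2(a + b))^δ ≤ 2 (a^δ + b^δ)` ("`2^δ/2 ≤ 1`", p.9:L97–101). [folklore] -/
private theorem rpow_two_mul_add_le {a b δ : ℝ} (ha : 0 ≤ a) (hb : 0 ≤ b) (hδ : 0 < δ) (hδ1 : δ < 1) :
    (2 * (a + b)) ^ δ ≤ 2 * (a ^ δ + b ^ δ) := by
  have h2δ : (2 : ℝ) ^ δ ≤ 2 := by
    have := Real.rpow_le_rpow_of_exponent_le (x := (2 : ℝ)) (by norm_num) hδ1.le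
    rwa [Real.rpow_one] at this
  calc (2 * (a + b)) ^ δ = (2 : ℝ) ^ δ * (a + b) ^ δ := Real.mul_rpow (by norm_num) (add_nonneg ha hb)
    _ ≤ 2 * (a ^ δ + b ^ δ) :=
        mul_le_mul h2δ (Real.rpow_add_le_add_rpow ha hb hδ.le hδ1.le)
          (Real.rpow_nonneg (add_nonneg ha hb) _) (by norm_num)

/-- **Theorem 2 (4), continuity in `E` and `V`** (statement p.8:L69–82, proof p.9:L34–125): "Let
`E, E' ∈ 𝓔(δ₀,g₀,G₀,w₀)` satisfy `|E|_{3,r}, |E'|_{3,r} ≤ G₃` and `|E − E'|_{3,r} < ε/2`. Then, for all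
`|λ| ≤ λ_R/2` and all `V, V' ∈ 𝓥` with `|V − V'|₂ ≤ 1`,
`|e^{(R)}(E,λV) − e^{(R)}(E',λV')|₂ ≤ 4(|E−E'|₂ + |E−E'|₁^δ + |E−E'|₀^{δ²} + |V−V'|₂^{δ²})`."
Abstract form: `K`, `K'` play `K^{(R)}(·,λV)`, `K^{(R)}(·,λV')`; `e`, `e'` are the solutions of
`e + K(e) = E`, `e' + K'(e') = E'` with "(Ala)" `|e − E|_{3,r}, |e' − E'|_{3,r} ≤ D_R|λ|` (part (3));
(dr0)–(dr2) hold on `B_ε^{(2)}(E)` (`IterationBounds`), and "(dr3)" is the hypothesis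
`|K(e') − K'(e')|₂ ≤ Q₀|λ| Δ_V` with `Δ_V = |V − V'|₂ ≤ 1`; `Q = max{Q₀ + Q₁(1+G₃), D}`, `Qλ_R < min{1,ε}`,
`G₃ ≥ |E|_{3,r}`.  The print uses `|E−E'|₀ ≤ 1` and `D|λ| + ε/2 < 1` (p.9:L40–46, L120–125), i.e.
`ε ≤ 1` — WLOG for Lemma 2's `ε`, carried here as a hypothesis.
[cite: FeldmanSalmhoferTrubowitz2000, Thm 2 (4) p.8:L69-82] -/
theorem deltasatz_continuity (hK : IterationBounds N0 N1 N2 K E ε δ lam D Q0 Q1) (hN : NormLadder N0 N1 N2)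
    {K' : X → X} {E' e e' : X} {G₃ lamR dV : ℝ} (hε1 : ε ≤ 1) (hG : ‖E‖ ≤ G₃)
    (hQ : bigQ Q0 Q1 D G₃ * lamR < min 1 ε) (hlam : |lam| ≤ lamR / 2)
    (hEE' : ‖E - E'‖ < ε / 2) (hdV0 : 0 ≤ dV) (hdV1 : dV ≤ 1)
    (hsol : e + K e = E) (he : ‖e - E‖ ≤ D * |lam|)
    (hsol' : e' + K' e' = E') (he' : ‖e' - E'‖ ≤ D * |lam|)
    (hdr3 : N2 (K e' - K' e') ≤ Q0 * |lam| * dV) :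
    N2 (e - e') ≤ 4 * (N2 (E - E') + N1 (E - E') ^ δ + N0 (E - E') ^ (δ ^ 2) + dV ^ (δ ^ 2)) := by
  have hδ := hK.delta_pos
  have hδ1 := hK.delta_lt_one
  have hδsq1 : δ ^ 2 < 1 := by nlinarith
  -- sizes of the constants: `Q₀|λ| < 1/2`, `Q₁(1+G₃)|λ| < 1/2`, `D|λ| < 1/2`, `D|λ| < ε/2`
  set Q := bigQ Q0 Q1 D G₃ with hQdef
  have hQD : D ≤ Q := D_le_bigQ Q0 Q1 D G₃
  have hQpos : 0 < Q := zero_lt_one.trans_le (hK.one_le_D.trans hQD)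
  have hal : 0 ≤ |lam| := abs_nonneg lam
  have hlamR : 0 ≤ lamR := by linarith
  have hQl1 : Q * lamR < 1 := hQ.trans_le (min_le_left _ _)
  have hQlε : Q * lamR < ε := hQ.trans_le (min_le_right _ _)
  have hε : 0 < ε := (mul_nonneg hQpos.le hlamR).trans_lt hQlε
  have hQlam : Q * |lam| ≤ Q * (lamR / 2) := mul_le_mul_of_nonneg_left hlam hQpos.le
  have hQ0_0 : 0 ≤ Q0 := zero_le_one.trans hK.one_le_Q0
  have hQ1_0 : 0 ≤ Q1 := zero_le_one.trans hK.one_le_Q1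
  have hG0 : 0 ≤ G₃ := (norm_nonneg E).trans hG
  have hQ0Q : Q0 ≤ Q :=
    (le_add_of_nonneg_right (mul_nonneg hQ1_0 (by positivity))).trans (Q0_add_le_bigQ Q0 Q1 D G₃)
  have hQ1Q : Q1 * (1 + G₃) ≤ Q := (le_add_of_nonneg_left hQ0_0).trans (Q0_add_le_bigQ Q0 Q1 D G₃)
  have hQ0half : Q0 * |lam| < 1 / 2 := by
    have := mul_le_mul_of_nonneg_right hQ0Q hal; linarith
  have hQ1half : Q1 * (1 + G₃) * |lam| < 1 / 2 := by
    have := mul_le_mul_of_nonneg_right hQ1Q hal; linarith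
  have hDhalf : D * |lam| < 1 / 2 := by
    have := mul_le_mul_of_nonneg_right hQD hal; linarith
  have hDε2 : D * |lam| < ε / 2 := by
    have := mul_le_mul_of_nonneg_right hQD hal; linarith
  have hQ0l0 : 0 ≤ Q0 * |lam| := mul_nonneg hQ0_0 hal
  -- both `e` and `e'` lie in `B_ε^{(2)}(E)` with `|· - E|_{3,r} ≤ 1` (p.9:L37-47)
  have he'Ele : ‖e' - E‖ ≤ ‖e' - E'‖ + ‖E - E'‖ := by
    calc ‖e' - E‖ = ‖(e' - E') + (E' - E)‖ := by rw [sub_add_sub_cancel]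
      _ ≤ ‖e' - E'‖ + ‖E' - E‖ := norm_add_le _ _
      _ = ‖e' - E'‖ + ‖E - E'‖ := by rw [← norm_neg (E' - E), neg_sub]
  have heE : ‖e - E‖ < 1 := by linarith
  have he'E : ‖e' - E‖ < 1 := by linarith
  have heB : N2 (e - E) < ε := (hN.le2 _).trans_lt (by linarith)
  have he'B : N2 (e' - E) < ε := (hN.le2 _).trans_lt (by linarith)
  have hS : ∀ t ∈ Set.Icc (0 : ℝ) 1, ‖(1 - t) • e' + t • e‖ ≤ 1 + G₃ :=
    fun t ht => (norm_convexComb_le he'E.le heE.le ht).trans (by linarith)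
  -- the basic identity `E - E' = (e - e') + (K e - K e') + (K e' - K' e')` (p.9:L49-55)
  have hid : e - e' = (E - E') - (K e - K e') - (K e' - K' e') := by
    rw [← hsol, ← hsol']; abel
  -- triangle inequality in each norm
  have tri : ∀ N : Seminorm ℝ X,
      N (e - e') ≤ N (E - E') + N (K e - K e') + N (K e' - K' e') := by
    intro N
    rw [hid]
    exact (map_sub_le_add N _ _).trans (add_le_add (map_sub_le_add N _ _) le_rfl)
  -- abbreviations
  set a0 := N0 (e - e') with ha0
  set a1 := N1 (e - e') with ha1
  set a2 := N2 (e - e') with ha2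
  set b0 := N0 (E - E') with hb0
  set b1 := N1 (E - E') with hb1
  set b2 := N2 (E - E') with hb2
  have ha0n : 0 ≤ a0 := apply_nonneg _ _
  have ha1n : 0 ≤ a1 := apply_nonneg _ _
  have ha2n : 0 ≤ a2 := apply_nonneg _ _
  have hb0n : 0 ≤ b0 := apply_nonneg _ _
  have hb1n : 0 ≤ b1 := apply_nonneg _ _
  have hb2n : 0 ≤ b2 := apply_nonneg _ _
  have hb0le1 : b0 ≤ 1 := by
    have : b0 ≤ ‖E - E'‖ := ((hN.le01 _).trans (hN.le12 _)).trans (hN.le2 _)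
    linarith
  -- the `V`-term in the three norms ((dr3) and `|·|₀ ≤ |·|₁ ≤ |·|₂`)
  have hV2 : N2 (K e' - K' e') ≤ Q0 * |lam| * dV := hdr3
  have hV1 : N1 (K e' - K' e') ≤ Q0 * |lam| * dV := (hN.le12 _).trans hV2
  have hV0 : N0 (K e' - K' e') ≤ Q0 * |lam| * dV := (hN.le01 _).trans hV1
  have hVd : Q0 * |lam| * dV ≤ 1 / 2 * dV := mul_le_mul_of_nonneg_right hQ0half.le hdV0
  -- (dr0)-(dr2) between `e'` and `e` (as `e₀ = e'`, `e₁ = e`)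
  have d0 := hK.dr0 e' e he'B heB
  have d1 := hK.dr1 e' e he'B heB
  have d2 := hK.dr2 e' e (1 + G₃) he'B heB hS
  -- elementary `rpow` facts
  have hdVδ : dV ≤ dV ^ δ := Real.self_le_rpow_of_le_one hdV0 hdV1 hδ1.le
  have hb0δ2 : b0 ≤ b0 ^ (δ ^ 2) := Real.self_le_rpow_of_le_one hb0n hb0le1 hδsq1.le
  have hdVδ2 : dV ≤ dV ^ (δ ^ 2) := Real.self_le_rpow_of_le_one hdV0 hdV1 hδsq1.le
  have ha0δn : 0 ≤ a0 ^ δ := Real.rpow_nonneg ha0n _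
  have ha1δn : 0 ≤ a1 ^ δ := Real.rpow_nonneg ha1n _
  have hb0δn : 0 ≤ b0 ^ δ := Real.rpow_nonneg hb0n _
  have hb1δn : 0 ≤ b1 ^ δ := Real.rpow_nonneg hb1n _
  have hdVδn : 0 ≤ dV ^ δ := Real.rpow_nonneg hdV0 _
  have hb0δ2n : 0 ≤ b0 ^ (δ ^ 2) := Real.rpow_nonneg hb0n _
  have hdVδ2n : 0 ≤ dV ^ (δ ^ 2) := Real.rpow_nonneg hdV0 _
  have h2δ : (2 : ℝ) ^ δ ≤ 2 := by
    have := Real.rpow_le_rpow_of_exponent_le (x := (2 : ℝ)) (by norm_num) hδ1.le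
    rwa [Real.rpow_one] at this
  -- |·|₀ (p.9:L84-91): `a0 ≤ 2 b0 + dV`
  have p0 : Q0 * |lam| * a0 ≤ 1 / 2 * a0 := mul_le_mul_of_nonneg_right hQ0half.le ha0n
  have h0 : a0 ≤ 2 * b0 + dV := by linarith [tri N0]
  -- |·|₁ (p.9:L93-101): `a1 ≤ 2 (b1 + b0^δ + dV^δ)`
  have ha0δ : a0 ^ δ ≤ 2 * b0 ^ δ + dV ^ δ := by
    calc a0 ^ δ ≤ (2 * b0 + dV) ^ δ := Real.rpow_le_rpow ha0n h0 hδ.le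
      _ ≤ (2 * b0) ^ δ + dV ^ δ := Real.rpow_add_le_add_rpow (by positivity) hdV0 hδ.le hδ1.le
      _ = (2 : ℝ) ^ δ * b0 ^ δ + dV ^ δ := by rw [Real.mul_rpow (by norm_num) hb0n]
      _ ≤ 2 * b0 ^ δ + dV ^ δ := by gcongr
  have p1a : Q0 * |lam| * a0 ^ δ ≤ 1 / 2 * a0 ^ δ := mul_le_mul_of_nonneg_right hQ0half.le ha0δn
  have p1b : Q0 * |lam| * a1 ≤ 1 / 2 * a1 := mul_le_mul_of_nonneg_right hQ0half.le ha1n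
  have h1 : a1 ≤ 2 * (b1 + b0 ^ δ + dV ^ δ) := by linarith [tri N1]
  -- |·|₂ (p.9:L103-125)
  have ha1δ : a1 ^ δ ≤ 2 * (b1 ^ δ + b0 ^ (δ ^ 2) + dV ^ (δ ^ 2)) := by
    calc a1 ^ δ ≤ (2 * (b1 + b0 ^ δ + dV ^ δ)) ^ δ := Real.rpow_le_rpow ha1n h1 hδ.le
      _ = (2 * (b1 + (b0 ^ δ + dV ^ δ))) ^ δ := by ring_nf
      _ ≤ 2 * (b1 ^ δ + (b0 ^ δ + dV ^ δ) ^ δ) :=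
          rpow_two_mul_add_le hb1n (add_nonneg hb0δn hdVδn) hδ hδ1
      _ ≤ 2 * (b1 ^ δ + ((b0 ^ δ) ^ δ + (dV ^ δ) ^ δ)) := by
          gcongr
          exact Real.rpow_add_le_add_rpow hb0δn hdVδn hδ.le hδ1.le
      _ = 2 * (b1 ^ δ + b0 ^ (δ ^ 2) + dV ^ (δ ^ 2)) := by
          rw [← Real.rpow_mul hb0n, ← Real.rpow_mul hdV0, ← sq]; ring
  have hK2 : N2 (K e - K e') ≤ ‖K e - K e'‖ := hN.le2 _
  have p2a : Q0 * |lam| * a1 ^ δ ≤ 1 / 2 * a1 ^ δ := mul_le_mul_of_nonneg_right hQ0half.le ha1δn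
  have p2b : Q0 * |lam| * a2 ≤ 1 / 2 * a2 := mul_le_mul_of_nonneg_right hQ0half.le ha2n
  have p2c : Q1 * |lam| * (1 + G₃) * a0 ≤ 1 / 2 * a0 := by
    rw [show Q1 * |lam| * (1 + G₃) = Q1 * (1 + G₃) * |lam| by ring]
    exact mul_le_mul_of_nonneg_right hQ1half.le ha0n
  have h2 : a2 ≤ 2 * b2 + a1 ^ δ + a0 + dV := by linarith [tri N2]
  linarith

end Iteration

end FST4

end Literature.MathematicalPhysics.QuantumLattice.FermiRG
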